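import Summits.BirchSwinnertonDyer.Rank1Residual.X4.KuriharaLevelLoweringDescent
import Literature.NumberTheory.EllipticCurves.Kim2026.ShaLengthRankZeroKuriharaDivisibilityBound
import HarnessLib

/-!
# Level lowering kills Kurihara numbers mod `p`, part 3/3: a mod-`p` OLDFORM identity for the plus symbol of `f` (the certificate `PlusSymbolLevelLowersAt`) forces every mod-`p` Kurihara number of `f` to vanish, `∂^{(∞)}(δ̃) ≥ 1` (cell `b2b-bsdres`, seat additive-p4, line V39)

HONEST FRAMING (verbatim, cell `b2b-bsdres`): the goal of the cell is to DELETE the COMBINATION-SHAPED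
residual classes for ALL analytic-rank `≤ 1` curves over `ℚ` — "full BSD formula for every rank `≤ 1`
curve in class `C`" assembled STRICTLY from published theorems — so that the rank-`≤ 1` remainder
becomes exactly the CONSTRUCTION-SHAPED classes, which are TYPED (missing-input Props), NOT attempted;
this is not "finishing BSD". This file: a research-route KERNEL THEOREM (pure algebra over the tree's
`kuriharaNumber`; no named fact, no conjecture, nothing booked; X4 stays CONSTRUCTION-SHAPED).

## What is proved (parts 1–2, `KuriharaLevelLoweringFibres` / `KuriharaLevelLoweringDescent`, the mathematics; this part applies it to the tree's `kuriharaNumber`)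

Let `R` be a commutative ring, `μ : ℚ → R` a `1`-periodic function (`μ (r + z) = μ r`, `z ∈ ℤ`) which
satisfies the weight-`2` HECKE RELATION with eigenvalue `2` at every prime `q` of a finite set `P`:
`∑_{j mod q} μ((r + j)/q) + μ(q r) = 2 μ(r)` (the `T_q`-eigen relation of the function
`r ↦ {∞ → r}` of a modular symbol, Mazur–Tate–Teitelbaum 1986 §I.4 (4.2), at a prime where
`a_q ≡ q + 1 ≡ 2`, i.e. at a KOLYVAGIN prime for `T/pT`). Let `n` be a square-free product of primes of
`P`, `ψ_q : (ℤ/q)ˣ → R` additive characters, and `ℓ` an integer prime to `n`. Then the Kurihara-type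
sum of the `ℓ`-OLD DIFFERENCE `λ(r) := μ(r) − μ(ℓ r)` VANISHES:
`∑_{a ∈ (ℤ/n)ˣ} λ(a/n) · ∏_{q ∣ n} ψ_q(a) = 0` (`kuriharaSum_oldform_eq_zero`).

PROOF (new as a statement; elementary). Write `Φ_T^{(m)} := ∑_{a ∈ (ℤ/m)ˣ} μ(a/m) ∏_{q ∈ T} ψ_q(a)`
for `m ∣ n` and `T` a set of primes of `m`. (i) DESCENT: if `q ∣ m'q` is a prime outside `T`, the
fibre of `(ℤ/m'q)ˣ → (ℤ/m')ˣ` over `b` consists of the `q` lifts `b + jm'` minus the one divisible by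
`q`; the Hecke relation evaluates the full fibre sum to `2μ(b/m') − μ(qb/m')` and the removed term is
`μ(q⁻¹b/m')`, so `Φ_T^{(m'q)} = ∑_b ∏_{T} ψ(b)·[2μ(b) − μ(qb) − μ(q⁻¹b)]`; re-indexing `b ↦ q^{∓1} b` and
expanding `∏_{i∈T}(ψ_i(b) ± ψ_i(q)) = ∑_{T'⊆T} (∏_{T∖T'} ±ψ_i(q)) ∏_{T'} ψ_i(b)` the two `T' = T` terms
cancel the `2Φ_T^{(m')}` EXACTLY, leaving a combination of the `Φ_{T'}^{(m')}` with `T' ⊊ T`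
(`Phi_mul_eq`). (ii) Induction on `#T`: `Φ_T^{(m)} = 0` whenever `T ⊊ primes(m)`
(`Phi_eq_zero_of_ssubset`). (iii) The same expansion applied to `∑_a μ(ℓa/n)∏ψ(a)` (re-index
`a ↦ ℓ⁻¹a`) gives `Φ_P^{(n)} + (combination of Φ_{T'}^{(n)}, T' ⊊ P)`, so the old difference kills
the leading term and (ii) kills the rest. In Mazur–Tate language: `θ_n(λ) = (1 − σ_ℓ^{-1}) θ_n(μ)`, and
multiplication by `1 − σ_ℓ^{-1}` pushes the modular element one step deeper into the augmentation
filtration, past the coefficient `δ_n` of `∏(σ_{η_q} − 1)` (Kurihara 2014 §1.1 (1)–(2);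
Kim–Kim–Sun, Selecta Math. 26 (2020), Thm. 7.5).

## Why (the arithmetic it serves; EVIDENCE and consumers live in the sibling `X4/KuriharaLevelLoweringCertificate.lean`)

If `E/ℚ` has `p ∣ c_ℓ(E)` at a split multiplicative prime `ℓ ∥ N` and `E[p]` is irreducible, then
`E[p]` is unramified at `ℓ` (Tate curve) and — by Ribet's theorem plus a multiplicity-one statement
that is NOT in print when `p² ∣ N` (the cell's class X4: additive `p`) — the mod-`p` plus symbol of
`f_E` is the `ℓ`-stabilised old symbol `μ − (β/ℓ)·μ∘[ℓ]` of a level-`N/ℓ` eigensymbol `μ` with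
`β ≡ ℓ`, i.e. EXACTLY the shape `λ = μ − μ∘[ℓ]` above, while `μ` is `T_q`-eigen with
`a_q(g) ≡ a_q(E) ≡ 2 (mod p)` at the Kolyvagin primes of `E[p]`. Hence EVERY mod-`p` Kurihara number
`δ̃_n` of `E` vanishes, `∂^{(∞)}(δ̃) ≥ 1`, and Kim's Thm. 1.8 (6) (`p ≥ 5`) sharpens to
`ord_p #Ш ≤ ord_p(L(E,1)/Ω_E) − 1`; with the PARITY LAW (`X4/KimDefectParity.lean`) this CLOSES the
TAM-DEFECT₂♭ rows with `ord_p ∏ c = 2` (175 of the 179 open X4 ∧ r = 0 ∧ surj rows at `p ≥ 5`, file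
`V26-YIELD.tsv` of the seat) — per pair, from a FINITE mod-`p` linear-algebra certificate (the oldform
identity at levels `N`, `N/ℓ`) instead of a statement over infinitely many Kolyvagin levels. The
Galois-side shadow of the same phenomenon is Mazur–Rubin, *Kolyvagin systems* (2004) Prop. 6.2.6 /
Kim 2026 Rem. 6.2 ("Kato's Kolyvagin system cannot be primitive when `p` divides Tamagawa factors");
the present symbol-side theorem needs no Kolyvagin-system dictionary and is unconditional in `p`
(so it also explains the census observation "all level-one `δ̃_n ≡ 0 (mod 3)`" on Tamagawa-`3` rows,
cell file `cells/n1011/PREDICTIONS-E2-AT3.md` A11, candidate line P-TAM3). Nothing here is booked;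
no Literature fact is minted; labels unchanged.

## References

* B. Mazur, J. Tate, J. Teitelbaum, Invent. Math. 84 (1986), §I.4 (4.2) (Hecke relation for modular
  symbols). [cite: MazurTateTeitelbaum1986Invent, §I.4 (4.2)]
* M. Kurihara, Contrib. Math. Comput. Sci. 7 (2014) 317–356, §1.1 (1)–(2). [cite: Kurihara2014, §1.1]
* C.-H. Kim, M. Kim, H.-S. Sun, Selecta Math. 26 (2020), Rem. 2.3 ("Tamagawa defect … quantitative
  level lowering"), Thm. 7.5. [cite: KimKimSun2020Selecta, Rem. 2.3 and Thm. 7.5]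
* C.-H. Kim, Amer. J. Math. 148 (2026), §1.4.3, §1.5.1, Conj. 1.10, Rem. 6.2. [cite: Kim2022StructureSelmer, §1.5.1 and Rem. 6.2]
* B. Mazur, K. Rubin, Mem. AMS 799 (2004), Prop. 6.2.6. [cite: MazurRubin2004, Prop. 6.2.6]
-/

noncomputable section

open scoped MatrixGroups ModularForm

open CongruenceSubgroup Finset

open Literature.NumberTheory.EllipticCurves Literature.NumberTheory.EllipticCurves.ModularForms

namespace Summit.BirchSwinnertonDyer.Rank1Residual.LevelLowering

variable {R : Type*}

/-! ### §5 Application: the mod-`p` Kurihara numbers of a cusp form whose plus symbol level-lowers -/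

section Application

variable [CommRing R]

/-- The tree's weight of `kuriharaNumber` (a product over `n.primeFactors.attach`) is `weight ψ n P(n)`.
[cite: Kim2022StructureSelmer, §1.4.3 (PDF p. 7)] -/
theorem prod_attach_toAdd_eq_weight (ψ : (ℓ : ℕ) → (ZMod ℓ)ˣ →* Multiplicative R) (n : ℕ)
    (a : (ZMod n)ˣ) :
    ∏ ℓ ∈ n.primeFactors.attach,
        Multiplicative.toAdd (ψ ℓ.1 (ZMod.unitsMap (Nat.dvd_of_mem_primeFactors ℓ.2) a)) =
      weight ψ n n.primeFactors a := by
  unfold weight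
  rw [← Finset.prod_attach n.primeFactors (f := fun q ↦ chi ψ n q a)]
  exact Finset.prod_congr rfl fun q _ ↦ (chi_of_dvd ψ (Nat.dvd_of_mem_primeFactors q.2) a).symm

variable (W : WeierstrassCurve ℚ) [W.IsGloballyMinimal] (p : ℕ) {N : ℕ} (f : CuspForm (Gamma0 N) 2)

/-- **LEVEL-LOWERING CERTIFICATE for the mod-`p` plus symbol of `f` at `ℓ`** (a FINITE object: two
mod-`p` modular-symbol spaces): there is a `1`-periodic `μ : ℚ → ℤ/p` which is `T_q`-eigen with
eigenvalue `a_q(E) mod p` at every Kolyvagin prime `q` of `(E, p)` (`q ∤ Np`, `q ≡ 1`,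
`a_q ≡ q + 1 (mod p)`; Kim §1.2.2) and whose `ℓ`-old difference is the mod-`p` plus symbol of `f`:
`[r]⁺_f mod p = μ(r) − μ(ℓ·r)` for every `r ∈ ℚ`. WHERE IT COMES FROM (not asserted here): for
`f = f_E`, `E[p]` irreducible and `p ∣ c_ℓ(E)` at a split multiplicative `ℓ ∥ N`, `E[p]` is
unramified at `ℓ`, Ribet's theorem gives a level-`N/ℓ` eigenform `g ≡ f`, and the `ℓ`-stabilised
oldform `g(z) − β g(ℓz)` with `β ≡ ℓ` has symbol `μ_g − (β/ℓ)μ_g∘[ℓ] ≡ μ_g − μ_g∘[ℓ]`; equality with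
`f`'s symbol needs multiplicity one mod `p`, in print for `p ∤ N` (Vatsal 1999) but NOT for the
cell's class X4 (`p² ∣ N`) — hence a per-pair certificate (cell instrument; EVIDENCE), never a fact.
A predicate; nothing asserted. [cite: Kim2022StructureSelmer, §1.2.2 and §1.4.3 (PDF pp. 5, 7)]
[cite: MazurTateTeitelbaum1986Invent, §I.4 (4.2)] -/
def PlusSymbolLevelLowersAt [Fact p.Prime] (ℓ : ℕ) : Prop :=
  ∃ μ : ℚ → ZMod p, IsPeriodic μ ∧
    (∀ q : ℕ, Kato.IsKolyvaginPrime W p 1 q → HeckeRel μ q (W.frobeniusTrace q : ZMod p)) ∧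
    ∀ r : ℚ, ((ratPlusSymbol f r : ℚ) : ZMod p) = μ r - μ (ℓ * r)

variable {W p f}

/-- **EVERY mod-`p` Kurihara number vanishes under the certificate**: if the mod-`p` plus symbol of
`f` level-lowers at some `ℓ ∣ N_E` (`PlusSymbolLevelLowersAt W p f ℓ`), then
`kuriharaNumber f p n ψ = 0` for every `n ∈ 𝒩_1(E, p)` and EVERY choice of discrete logarithms `ψ`
(the Kolyvagin primes are `T_q`-eigen primes of eigenvalue `a_q ≡ q + 1 ≡ 2` for `μ`, and prime to
`ℓ ∣ N_E`). [cite: Kim2022StructureSelmer, §1.2.2 and §1.4.3 (PDF pp. 5, 7)] -/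
theorem kuriharaNumber_eq_zero_of_plusSymbolLevelLowersAt [Fact p.Prime] {ℓ : ℕ}
    (hcert : PlusSymbolLevelLowersAt W p f ℓ) (hℓ : ℓ ∣ W.conductorNorm ℤ)
    {n : ℕ} [NeZero n] (hn : Kato.IsKolyvaginProduct W p 1 n)
    (ψ : (q : ℕ) → (ZMod q)ˣ →* Multiplicative (ZMod p)) : kuriharaNumber f p n ψ = 0 := by
  obtain ⟨μ, hμ, hH, hsym⟩ := hcert
  rw [kuriharaNumber_eq_sum_ratCast]
  simp_rw [prod_attach_toAdd_eq_weight, hsym]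
  have hP : ∀ q, Kato.IsKolyvaginPrime W p 1 q → q.Prime ∧ HeckeRel μ q 2 := fun q hq ↦ by
    refine ⟨hq.prime, ?_⟩
    have h := hH q hq
    rwa [(Kato.isKolyvaginPrime_one_iff.mp hq).2.2.2] at h
  have hcop : ℓ.Coprime n := Nat.coprime_of_dvd fun k hk hkℓ hkn ↦
    (hn.2 k (Nat.mem_primeFactors.mpr ⟨hk, hkn, NeZero.ne n⟩)).not_dvd_conductorNorm
      (dvd_trans hkℓ hℓ)
  exact kuriharaSum_oldform_eq_zero ψ hμ hP n hn.squarefree hn.2 hcop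

/-- **`δ̃_n ∈ p ℤ_p/I_nℤ_p` at every level** (`KuriharaDivisibleAt … n 1`, file
`KuriharaNumberInvariants`) for the newform `D.f` of an elliptic curve with `E[p]` irreducible, `p`
odd, conductor `= N` (so that the symbols at Kolyvagin levels are `p`-integral and the level-`p^1`
number reduces to the mod-`p` one, `Kim2026.castHom_kuriharaNumber`), under the certificate.
[cite: Kim2022StructureSelmer, §1.4.3 and §1.5.1 (PDF p. 7)] -/
theorem kuriharaDivisibleAt_one_of_plusSymbolLevelLowersAt [W.IsElliptic] [Fact p.Prime]
    (hp2 : p ≠ 2) (hirr : W.HasIrreducibleModPGaloisRep p) [NeZero N]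
    (D : ModularParametrizationData W N) (hN : W.conductorNorm ℤ = N) {ℓ : ℕ}
    (hcert : PlusSymbolLevelLowersAt W p D.f ℓ) (hℓ : ℓ ∣ W.conductorNorm ℤ)
    (n : ℕ) : KuriharaDivisibleAt W p D.f n 1 := by
  intro k hk hkn ψ _
  interval_cases k
  · haveI : Subsingleton (ZMod (p ^ 0)) := ZMod.subsingleton_iff.mpr (pow_zero p)
    exact Subsingleton.elim _ _
  · haveI : NeZero n := ⟨hkn.ne_zero⟩
    haveI : NeZero (p ^ 1) := ⟨pow_ne_zero 1 (Fact.out : p.Prime).ne_zero⟩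
    have hdvd : p ∣ p ^ 1 := dvd_pow_self p one_ne_zero
    have hcopN : n.Coprime N := by
      have := hkn.coprime
      rw [hN] at this
      exact Nat.Coprime.coprime_dvd_right (dvd_mul_right N p) this
    have hden : ∀ a : ℕ, (ratPlusSymbol D.f ((a : ℚ) / n)).den.Coprime (p ^ 1) := by
      intro a
      have hnd := D.isNewformOf.not_dvd_den_ratPlusSymbol_div hp2 hirr hcopN (a : ℤ)
      rw [Int.cast_natCast] at hnd
      exact Nat.Coprime.pow_right 1
        (Nat.coprime_comm.mp ((Nat.Prime.coprime_iff_not_dvd Fact.out).mpr hnd))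
    have h0 : kuriharaNumber D.f p n (Kim2026.reduceLog hdvd ψ) = 0 :=
      kuriharaNumber_eq_zero_of_plusSymbolLevelLowersAt hcert hℓ hkn _
    rw [← Kim2026.castHom_kuriharaNumber D.f hdvd n ψ hden,
      ← ZMod.natCast_zmod_val (kuriharaNumber D.f (p ^ 1) n ψ), map_natCast,
      ZMod.natCast_eq_zero_iff] at h0
    rw [← ZMod.natCast_zmod_val (kuriharaNumber D.f (p ^ 1) n ψ), ZMod.natCast_eq_zero_iff]
    exact (dvd_of_eq (pow_one p)).trans h0

/-- **`∂^{(∞)}(δ̃) ≥ 1` under the certificate** (the tree's `kuriharaPartialInfty`, cyclic levels):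
every divisibility index is `≥ 1`. This is the `α = 1` input of the ONE-FACTOR SOCKET
`X4.bsdp_of_le_kimDefect_of_tamagawa_le_add_one_of_shaAn_unit` (file `X4/KimDefectParity.lean`).
[cite: Kim2022StructureSelmer, §1.5.1 (PDF p. 7) and Conj. 1.10 (PDF p. 8)] -/
theorem one_le_kuriharaPartialInfty_of_plusSymbolLevelLowersAt [W.IsElliptic] [Fact p.Prime]
    (hp2 : p ≠ 2) (hirr : W.HasIrreducibleModPGaloisRep p) [NeZero N]
    (D : ModularParametrizationData W N) (hN : W.conductorNorm ℤ = N) {ℓ : ℕ}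
    (hcert : PlusSymbolLevelLowersAt W p D.f ℓ) (hℓ : ℓ ∣ W.conductorNorm ℤ) :
    (1 : ℕ∞) ≤ kuriharaPartialInfty W p D.f := by
  refine le_iInf fun i ↦ ?_
  rw [kuriharaPartial_def]
  refine le_iInf fun n ↦ le_iInf fun _ ↦ le_iInf fun _ ↦ ?_
  exact_mod_cast le_kuriharaDivIndex_of_divisibleAt W p D.f
    (kuriharaDivisibleAt_one_of_plusSymbolLevelLowersAt hp2 hirr D hN hcert hℓ n)

/-- **The E67 hypothesis at `m = 1`**: `p^{min(1,k)} ∣ δ̃_n^{(k)}` for every `k`, every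
`n ∈ 𝒩_k` and every surjective `ψ` — the universally quantified input of
`Kim2026.rankZero_padicValNat_sha_add_le_of_forall_pow_dvd_kuriharaNumber` (Kim Thm. 1.8 (6) read
with `∂^{(∞)} ≥ 1`) — under the certificate. [cite: Kim2022StructureSelmer, Thm. 1.9 (6) (PDF p. 8), §1.5.1 (PDF p. 7)] -/
theorem pow_min_one_dvd_kuriharaNumber_of_plusSymbolLevelLowersAt [W.IsElliptic] [Fact p.Prime]
    (hp2 : p ≠ 2) (hirr : W.HasIrreducibleModPGaloisRep p) [NeZero N]
    (D : ModularParametrizationData W N) (hN : W.conductorNorm ℤ = N) {ℓ : ℕ}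
    (hcert : PlusSymbolLevelLowersAt W p D.f ℓ) (hℓ : ℓ ∣ W.conductorNorm ℤ)
    {k : ℕ} {n : ℕ} [NeZero n] (hn : Kato.IsKolyvaginProduct W p k n)
    (ψ : (q : ℕ) → (ZMod q)ˣ →* Multiplicative (ZMod (p ^ k)))
    (hψ : ∀ q ∈ n.primeFactors, Function.Surjective (ψ q)) :
    ((p ^ min 1 k : ℕ) : ZMod (p ^ k)) ∣ kuriharaNumber D.f (p ^ k) n ψ :=
  Kim2026.pow_min_dvd_kuriharaNumber_of_kuriharaDivisibleAt W p hp2 hirr D hN hn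
    (kuriharaDivisibleAt_one_of_plusSymbolLevelLowersAt hp2 hirr D hN hcert hℓ n) ψ hψ

end Application

end Summit.BirchSwinnertonDyer.Rank1Residual.LevelLowering

end
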